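import Summits.CriticalPhenomena.SAWScalingLimit.Theorems.SAWTotalPositivityCriticalBubbleBoundKestenCutMap
import Summits.CriticalPhenomena.SAWScalingLimit.Theorems.CriticalBubbleBound.Negative.CriticalBubbleBoundUnrootedPolygons

/-!
# Line `kesten-product-renewal-dictionary` (crux stmt-CriticalPhenomena-7117): the two-bridge cut, VI —
the cut on polygon CLASSES (`PolygonCut`, stub A1 of the registered skeleton)

Proof file (lead seat c1). The registered skeleton of the line (seat …-7117-1) phrases stub A on the polygon
normal form `polygonSeries = Σ_N N q_N x_c^N`: its stub A1 `PolygonCut` asks for an INJECTIVE map from the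
critical polygon classes (canonical SAP words of all lengths, `Negative.CanonSigma`) to apex-meeting, only-apex
bridge pairs of total length `N + 1`, and its landed stub A2 `Kesten.stub_cutSum` turns that into
`polygonSeries ≤ μ · Σ_h M₂(h)`. Here `PolygonCut` is DERIVED from the cut of parts I–III: a canonical word `w`
of length `N` is read (via the landed arch map `Negative.archSigma`) as an `(N-1)`-step self-avoiding walk
`0 → e₀` rooted at the lowest-then-leftmost vertex of its polygon; its two-bridge cut `(W₁, W₂)` is the value of
the map. Injectivity WITHOUT the root position: for walks rooted at the lowest-then-leftmost vertex the
translation, the direction of travel and the root position are all read off the translation-free shape of the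
polygon (`rootPos_eq_of_rooted`), so `eq_of_cut_eq` applies; then `archSigma_injective`.

Main result: `polygon_cut` — verbatim the hypothesis of `Kesten.stub_cutSum`.
-/

noncomputable section

open Literature.Probability.LatticeModels
open Literature.Probability.RandomPlanarGeometry Literature.Probability.RandomPlanarGeometry.SAW
open scoped BigOperators
open Summit.CriticalPhenomena.SAWScalingLimit.Theorems.CriticalBubbleBound.Negative
  (e₀ adj_zero_e₀ CanonSigma archSigma archSigma_injective archOf canon_facts getVert_archOf length_archOf
    mem_canonSet)
open Literature.Barriers.CriticalPhenomena (Haruspicy.key Haruspicy.key_le_key Haruspicy.key_injective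
  Haruspicy.key_sub_le_key_sub Haruspicy.IsRooted Haruspicy.length_rev)

namespace Summit.CriticalPhenomena.SAWScalingLimit.Theorems.CriticalBubbleBound.Kesten.Cut

variable {n : ℕ} {ω : ℕ → Site 2}

/-! ## Chain positions are injective; position `n + 1` is position `0` -/

/-- Distinct chain positions `≤ n` carry distinct vertices. [folklore] -/
theorem vtx_inj (hω : ω ∈ Zd.sawFun 2 n e₀) {j j' : ℕ} (hj : j ≤ n) (hj' : j' ≤ n)
    (h : vtx n ω j = vtx n ω j') : j = j' := by
  rcases pos_inj hω (by omega) (by omega) h with h | h | h <;> omega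

/-- After a full period one is back at the base vertex. [folklore] -/
theorem vtx_period (hω : ω ∈ Zd.sawFun 2 n e₀) : vtx n ω (n + 1) = vtx n ω 0 := by
  rw [vtx, vtx, pos, pos, cyc_base_add_eq_iff hω]
  cases dir n ω <;> simp [off]

/-! ## Walks rooted at the lowest-then-leftmost vertex: everything is read off the shape -/

/-- For a walk whose vertices all have `(y,x)`-key at least that of the origin, the translation of the
cut is minus the `(y,x)`-least value of the shape. [folklore] -/
theorem exists_shiftVec_eq_neg_shape (hω : ω ∈ Zd.sawFun 2 n e₀)
    (hr : ∀ i ≤ n, Haruspicy.key 0 ≤ Haruspicy.key (ω i)) :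
    ∃ j₀ ≤ n, (∀ j ≤ n, Haruspicy.key (shape (fstWalk n ω) (sndWalk n ω) (arcLen n ω) n j₀) ≤
        Haruspicy.key (shape (fstWalk n ω) (sndWalk n ω) (arcLen n ω) n j)) ∧
      shiftVec n ω = -shape (fstWalk n ω) (sndWalk n ω) (arcLen n ω) n j₀ := by
  obtain ⟨j₀, hj₀, h0⟩ := exists_pos_eq hω (Nat.zero_le n)
  rw [apply_zero hω] at h0
  refine ⟨j₀, hj₀, fun j hj => ?_, ?_⟩
  · have hs : ∀ j ≤ n + 1, shape (fstWalk n ω) (sndWalk n ω) (arcLen n ω) n j = vtx n ω j - shiftVec n ω :=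
      fun j hj => by rw [vtx_eq_shape hj, add_sub_cancel_right]
    rw [hs j₀ (by omega), hs j (by omega), Haruspicy.key_sub_le_key_sub, ← h0]
    obtain ⟨i, hi, hci⟩ := cyc_mem (n := n) (ω := ω) (pos n ω (dir n ω) j)
    rw [vtx, hci]
    exact hr i hi
  · have := vtx_eq_shape (n := n) (ω := ω) (j := j₀) (by omega)
    rw [← h0] at this
    -- `0 = shape j₀ + T`
    rw [eq_neg_iff_add_eq_zero, add_comm]
    exact this.symm

/-- Two such walks with the same `W₁`, `W₂`, `ℓ` have the same translation. [folklore] -/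
theorem shiftVec_eq_of_rooted {ω ω' : ℕ → Site 2} (hω : ω ∈ Zd.sawFun 2 n e₀) (hω' : ω' ∈ Zd.sawFun 2 n e₀)
    (hr : ∀ i ≤ n, Haruspicy.key 0 ≤ Haruspicy.key (ω i))
    (hr' : ∀ i ≤ n, Haruspicy.key 0 ≤ Haruspicy.key (ω' i))
    (hshape : shape (fstWalk n ω) (sndWalk n ω) (arcLen n ω) n =
      shape (fstWalk n ω') (sndWalk n ω') (arcLen n ω') n) :
    shiftVec n ω = shiftVec n ω' := by
  obtain ⟨j₀, hj₀, hmin, hT⟩ := exists_shiftVec_eq_neg_shape hω hr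
  obtain ⟨j₀', hj₀', hmin', hT'⟩ := exists_shiftVec_eq_neg_shape hω' hr'
  have h1 := hmin j₀' hj₀'
  have h2 := hmin' j₀ hj₀
  rw [hshape] at h1 hT
  rw [hT, hT', Haruspicy.key_injective (le_antisymm h1 h2)]

/-- Two such walks with the same `W₁`, `W₂`, `ℓ` have the same root position. [folklore] -/
theorem rootPos_eq_of_rooted (hn : 2 ≤ n) {ω ω' : ℕ → Site 2} (hω : ω ∈ Zd.sawFun 2 n e₀)
    (hω' : ω' ∈ Zd.sawFun 2 n e₀) (hr : ∀ i ≤ n, Haruspicy.key 0 ≤ Haruspicy.key (ω i))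
    (hr' : ∀ i ≤ n, Haruspicy.key 0 ≤ Haruspicy.key (ω' i)) (hW₁ : fstWalk n ω = fstWalk n ω')
    (hW₂ : sndWalk n ω = sndWalk n ω') (hℓ : arcLen n ω = arcLen n ω') :
    rootPos n ω = rootPos n ω' := by
  have hshape : shape (fstWalk n ω) (sndWalk n ω) (arcLen n ω) n =
      shape (fstWalk n ω') (sndWalk n ω') (arcLen n ω') n := by rw [hW₁, hW₂, hℓ]
  have hT := shiftVec_eq_of_rooted hω hω' hr hr' hshape
  have hV : ∀ j ≤ n + 1, vtx n ω j = vtx n ω' j := fun j hj => by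
    rw [vtx_eq_shape hj, vtx_eq_shape hj, hshape, hT]
  have hm := rootPos_le (n := n) (ω := ω)
  have hm' := rootPos_le (n := n) (ω := ω')
  have he : (e₀ : Site 2) ≠ 0 := fun h => by have := congrFun h 0; simp [e₀] at this
  -- where do `0` and `e₀` sit on the common vertex function?
  -- `vtx ω j = 0` / `= e₀` happens at one position `≤ n` only
  have loc0 : ∀ {j j' : ℕ}, j ≤ n + 1 → j' ≤ n + 1 → vtx n ω j = 0 → vtx n ω j' = 0 →
      (j % (n + 1)) = (j' % (n + 1)) := by
    intro j j' hj hj' h h'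
    have key : ∀ {k : ℕ}, k ≤ n + 1 → vtx n ω k = vtx n ω (k % (n + 1)) := by
      intro k hk
      rcases Nat.lt_or_eq_of_le hk with hk' | rfl
      · rw [Nat.mod_eq_of_lt hk']
      · rw [Nat.mod_self, vtx_period hω]
    rw [key hj] at h; rw [key hj'] at h'
    exact vtx_inj hω (Nat.lt_succ_iff.1 (Nat.mod_lt _ (Nat.succ_pos n)))
      (Nat.lt_succ_iff.1 (Nat.mod_lt _ (Nat.succ_pos n))) (h.trans h'.symm)
  have locE : ∀ {j j' : ℕ}, j ≤ n + 1 → j' ≤ n + 1 → vtx n ω j = e₀ → vtx n ω j' = e₀ →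
      (j % (n + 1)) = (j' % (n + 1)) := by
    intro j j' hj hj' h h'
    have key : ∀ {k : ℕ}, k ≤ n + 1 → vtx n ω k = vtx n ω (k % (n + 1)) := by
      intro k hk
      rcases Nat.lt_or_eq_of_le hk with hk' | rfl
      · rw [Nat.mod_eq_of_lt hk']
      · rw [Nat.mod_self, vtx_period hω]
    rw [key hj] at h; rw [key hj'] at h'
    exact vtx_inj hω (Nat.lt_succ_iff.1 (Nat.mod_lt _ (Nat.succ_pos n)))
      (Nat.lt_succ_iff.1 (Nat.mod_lt _ (Nat.succ_pos n))) (h.trans h'.symm)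
  have hmodm : rootPos n ω % (n + 1) = rootPos n ω := Nat.mod_eq_of_lt (by omega)
  have hmodm' : rootPos n ω' % (n + 1) = rootPos n ω' := Nat.mod_eq_of_lt (by omega)
  have hsucc : ∀ {m : ℕ}, m ≤ n → (m + 1) % (n + 1) = if m = n then 0 else m + 1 := by
    intro m hm
    split_ifs with h
    · rw [h, Nat.mod_self]
    · exact Nat.mod_eq_of_lt (by omega)
  cases hd : dir n ω <;> cases hd' : dir n ω'
  · -- both traversed eastwards: `0` sits at both root positions
    have h1 := (vtx_rootPos_false hω hd).1
    have h2 := (vtx_rootPos_false hω' hd').1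
    rw [← hV _ (by omega)] at h2
    have := loc0 (by omega) (by omega) h1 h2
    rwa [hmodm, hmodm'] at this
  · exfalso
    have h1 := (vtx_rootPos_false hω hd).1
    have h2 := (vtx_rootPos_false hω hd).2
    have h3 := (vtx_rootPos_true hω' hd').1
    have h4 := (vtx_rootPos_true hω' hd').2
    rw [← hV _ (by omega)] at h3 h4
    have a := loc0 (by omega) (by omega) h1 h4
    have b := locE (by omega) (by omega) h2 h3
    rw [hmodm, hsucc hm'] at a
    rw [hsucc hm, hmodm'] at b
    split_ifs at a b <;> omega
  · exfalso
    have h1 := (vtx_rootPos_true hω hd).1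
    have h2 := (vtx_rootPos_true hω hd).2
    have h3 := (vtx_rootPos_false hω' hd').1
    have h4 := (vtx_rootPos_false hω' hd').2
    rw [← hV _ (by omega)] at h3 h4
    have a := locE (by omega) (by omega) h1 h4
    have b := loc0 (by omega) (by omega) h2 h3
    rw [hmodm, hsucc hm'] at a
    rw [hsucc hm, hmodm'] at b
    split_ifs at a b <;> omega
  · -- both traversed westwards: `e₀` sits at both root positions
    have h1 := (vtx_rootPos_true hω hd).1
    have h2 := (vtx_rootPos_true hω' hd').1
    rw [← hV _ (by omega)] at h2
    have := locE (by omega) (by omega) h1 h2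
    rwa [hmodm, hmodm'] at this

/-! ## The cut on polygon classes -/

/-- The arch of a canonical word of length `N`, as a vertex function, is an `(N-1)`-step self-avoiding
walk `0 → e₀` of the function model. [folklore] -/
theorem getVert_archSigma_mem (p : CanonSigma) :
    (archSigma p).1.1.getVert ∈ Zd.sawFun 2 (p.1 - 1) e₀ := by
  classical
  obtain ⟨N, w, hw⟩ := p
  have hwN := (mem_canonSet.1 hw).1
  unfold Zd.sawFun
  refine Finset.mem_image.2 ⟨(archSigma ⟨N, w, hw⟩).1.1, Finset.mem_filter.2 ⟨?_, (archSigma ⟨N, w, hw⟩).1.2⟩, rfl⟩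
  rw [SimpleGraph.mem_finsetWalkLength_iff]
  show (archOf w _).1.1.length = N - 1
  rw [length_archOf, hwN]

/-- Canonical words have length `≥ 4`, so their arches have `≥ 3 ≥ 2` steps. [folklore] -/
theorem two_le_of_canonSigma (p : CanonSigma) : 2 ≤ p.1 - 1 := by
  obtain ⟨N, w, hw⟩ := p
  have hwN := (mem_canonSet.1 hw).1
  have h4 := (canon_facts (mem_canonSet.1 hw).2).1
  show 2 ≤ N - 1
  omega

/-- The arch is rooted at the lowest-then-leftmost vertex of its polygon. [folklore] -/
theorem archSigma_rooted (p : CanonSigma) :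
    ∀ i ≤ p.1 - 1, Haruspicy.key 0 ≤ Haruspicy.key ((archSigma p).1.1.getVert i) := by
  obtain ⟨N, w, hw⟩ := p
  have hwN := (mem_canonSet.1 hw).1
  have hc := (mem_canonSet.1 hw).2
  have h4 := (canon_facts hc).1
  have hroot := (canon_facts hc).2.2.1
  intro i hi
  change i ≤ N - 1 at hi
  show Haruspicy.key 0 ≤ Haruspicy.key ((archOf w hc).1.1.getVert i)
  rw [getVert_archOf w hc (by omega)]
  exact hroot i (by rw [Haruspicy.length_rev]; omega)

/-- **`PolygonCut`** (stub A1 of the registered skeleton of the line, DERIVED from the two-bridge cut): an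
injective map from the critical polygon classes of `ℤ²` (canonical SAP words of all lengths) to
apex-meeting, only-apex pairs of bridges of total length `N + 1`. This is verbatim the hypothesis of the
landed `Kesten.stub_cutSum`, whence `polygonSeries ≤ μ · Σ_h M₂(h)`. [folklore] -/
theorem polygon_cut : ∃ g : CanonSigma → BridgePair, Function.Injective g ∧ ∀ p : CanonSigma, ApexMeet (g p) ∧ OnlyApex (g p) ∧ (g p).1.len + (g p).2.len = p.1 + 1 := by
  let ωOf : CanonSigma → ℕ → Site 2 := fun p => (archSigma p).1.1.getVert
  have hmem : ∀ p : CanonSigma, ωOf p ∈ Zd.sawFun 2 (p.1 - 1) e₀ := getVert_archSigma_mem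
  have h2 : ∀ p : CanonSigma, 2 ≤ p.1 - 1 := two_le_of_canonSigma
  let g : CanonSigma → BridgePair := fun p =>
    (⟨arcLen (p.1 - 1) (ωOf p) + 1, ⟨fstWalk (p.1 - 1) (ωOf p), fstWalk_mem_bridges (hmem p) (h2 p)⟩⟩,
      ⟨coLen (p.1 - 1) (ωOf p), ⟨sndWalk (p.1 - 1) (ωOf p), sndWalk_mem_bridges (hmem p) (h2 p)⟩⟩)
  refine ⟨g, ?_, ?_⟩
  · intro p p' h
    have hW₁ : fstWalk (p.1 - 1) (ωOf p) = fstWalk (p'.1 - 1) (ωOf p') :=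
      congrArg (fun q : BridgePair => q.1.fn) h
    have hW₂ : sndWalk (p.1 - 1) (ωOf p) = sndWalk (p'.1 - 1) (ωOf p') :=
      congrArg (fun q : BridgePair => q.2.fn) h
    have hℓ : arcLen (p.1 - 1) (ωOf p) = arcLen (p'.1 - 1) (ωOf p') :=
      Nat.succ_injective (congrArg (fun q : BridgePair => q.1.len) h)
    have hℓ' : coLen (p.1 - 1) (ωOf p) = coLen (p'.1 - 1) (ωOf p') :=
      congrArg (fun q : BridgePair => q.2.len) h
    -- same length
    have hN : p.1 = p'.1 := by
      have a := arcLen_add_coLen (n := p.1 - 1) (ω := ωOf p)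
      have b := arcLen_add_coLen (n := p'.1 - 1) (ω := ωOf p')
      have := h2 p; have := h2 p'
      omega
    obtain ⟨N, w, hw⟩ := p
    obtain ⟨N', w', hw'⟩ := p'
    change N = N' at hN
    subst hN
    -- same root position (both arches are rooted at the lowest-then-leftmost vertex), hence same walk
    have hm := rootPos_eq_of_rooted (h2 ⟨N, w, hw⟩) (hmem ⟨N, w, hw⟩) (hmem ⟨N, w', hw'⟩)
      (archSigma_rooted ⟨N, w, hw⟩) (archSigma_rooted ⟨N, w', hw'⟩) hW₁ hW₂ hℓ
    have hωω : ωOf ⟨N, w, hw⟩ = ωOf ⟨N, w', hw'⟩ :=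
      eq_of_cut_eq (hmem ⟨N, w, hw⟩) (hmem ⟨N, w', hw'⟩) hW₁ hW₂ hℓ hm
    -- same arch, same canonical word
    apply archSigma_injective
    apply Subtype.ext; apply Subtype.ext
    exact SimpleGraph.Walk.ext_getVert (congrFun hωω)
  · intro p
    refine ⟨?_, ?_, ?_⟩
    · show fstWalk (p.1 - 1) (ωOf p) (arcLen (p.1 - 1) (ωOf p) + 1) =
        sndWalk (p.1 - 1) (ωOf p) (coLen (p.1 - 1) (ωOf p)) + eUp
      rw [fstWalk_len (hmem p), sndWalk_len (hmem p), sub_add_cancel]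
    · intro i hi j hj h
      exact fst_eq_snd_add_iff (hmem p) (h2 p) hi hj h
    · show arcLen (p.1 - 1) (ωOf p) + 1 + coLen (p.1 - 1) (ωOf p) = p.1 + 1
      have := arcLen_add_coLen (n := p.1 - 1) (ω := ωOf p)
      have := h2 p
      omega

/-- Registered-stub form (seat …-7117-1's stub A1 `stub_polygonCut`, verbatim). [folklore] -/
theorem stub_polygonCut : ∃ g : CanonSigma → BridgePair, Function.Injective g ∧ ∀ p : CanonSigma, ApexMeet (g p) ∧ OnlyApex (g p) ∧ (g p).1.len + (g p).2.len = p.1 + 1 :=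
  polygon_cut

end Summit.CriticalPhenomena.SAWScalingLimit.Theorems.CriticalBubbleBound.Kesten.Cut

end
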